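import Literature.NumberTheory.GaloisCohomology.Howard2004.DVRSettingPiRefinementLevelData
import Literature.NumberTheory.GaloisCohomology.Howard2004.DVRSettingPiRefinementTowerProofs
import Literature.NumberTheory.GaloisCohomology.Howard2004.CartesianBaseChangeProofs
import Literature.NumberTheory.GaloisCohomology.Howard2004.PiAdicRefinementDualityDatumProofs
import Literature.NumberTheory.GaloisCohomology.Howard2004.PiAdicRefinementSelfOrthogonalProofs
import Literature.NumberTheory.GaloisCohomology.Howard2004.PiAdicRefinementDualityCompatProofs
import HarnessLib

/-!
# Howard 2004, §1.6 with Rem. 1.3.1: the `π`-adic refinement `S.refine` of a `DVRSetting` — the ASSEMBLY of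
# the refined setting (levels `T/π^{i+1}T` for every `i`) and its hypotheses H.0–H.5 clause by clause
# (definitions with bodies + theorems)

B. Howard, *The Heegner point Kolyvagin system*, Compositio Math. **140** (2004) (arXiv:1202.6340), proof of
Thm. 1.6.1 (arXiv p. 11 L33–38): «`R^{(k)} = R/𝔪^k`, `T^{(k)} = T/𝔪^k T` … By Remark 1.3.1 the Selmer triple
`(T^{(k)}, F, 𝓛^{(k)})` satisfies hypotheses H.0–H.5».  Brick (R6b) of the refinement constructor (REFINE, cell
`pub/bsd-print-x9`; LEAD ruling (β): Lemma 1.6.4 is proved on FULL settings and a general `DVRSetting` is REFINED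
to a full one).  It assembles the bricks R1 (`DVRSettingPiRefinement`), R2a/b (`…Rings`, `…Residual`), R3a/b
(`…Selmer`, `CartesianBaseChangeProofs`), R4 (`PiAdicRefinementDualityDatumProofs`, `…SelfOrthogonalProofs`,
`…DualityCompatProofs`), R6a (`…LevelData`), R7-TOWER♯ (`…TowerProofs`) into

* §1 **`DVRSetting.refine S hy pins : DVRSetting p K R N♯ Rk♯ Nbar Nq♯`** — level `i` is
  `T/π^{i+1}T = N (host (i+1)) ⧸ (π^{i+1})` over `R/π^{i+1}` (`e♯ i = i + 1`), with the SAME `π`, `cd`, `jbar`, `Σ`,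
  `𝓛`, `T̄`; the tower is `S.refinedTower hy`; the triples are the propagated ones (`refinedTriple`); the residual
  presentations `levelToResidual`, the `G_ℚ`-structure `residualTauQuot`, the H.4 data chosen from R4a's existence
  theorem (`Classical.choose`), the level data `refinedLD` with the TAME slots of the pin family `pins` (LEAD ruling
  2026-08-29: the refined setting is tame-pinned by a parameter), the reductions `refinedRq` / `refinedFsQ`.  The
  level rings carry their discrete topology / locality / residual module structure through `letI`/`haveI`
  (`refineInst*`; no instance is declared), exactly as the Eisenstein frames do;
* §2 the clauses of `SatisfiesH` for `S.refine`: `ker_refinedRed`, `levelToResidual_refinedRed`, `refineD_isSelfOrthogonal`,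
  `refineRedR_refineD_e`, `refineD_h5c`,
  `refine_h5b`, and **`refine_satisfiesH : (S.refine hy pins).SatisfiesH`** — Remark 1.3.1 for the whole tower;
* §3 `refine_largePrimes_iff` (`𝓛_s ⊂ 𝓛` for `s ≫ 0` transfers both ways, R7-TOWER♯).

Definitions with bodies and theorems only: no named fact, no instance, no notation, no `sorry`.  The refined
Kolyvagin system (R7-KS♯) and the (COFINAL) wrapper are NOT here.  `thm161_dvrKolyvaginBound` is NOT proved;
BSD is not proved by any of this.
-/

set_option autoImplicit false

noncomputable section

open Function NumberField IsDedekindDomain Field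
open scoped NumberField ContRepresentation Classical TensorProduct

namespace Literature.NumberTheory.GaloisCohomology.Howard2004

open Literature.NumberTheory.GaloisRepresentations
open Literature.NumberTheory.GaloisRepresentations.DiscreteGaloisModule

namespace DVRSetting

variable {p : ℕ} [Fact p.Prime] {K : Type} [Field K] [NumberField K]
  {R : Type} [CommRing R] [IsDomain R] [IsDiscreteValuationRing R] [Algebra ℤ_[p] R]
  {N : ℕ → Type} [∀ k, AddCommGroup (N k)] [∀ k, TopologicalSpace (N k)]
  [∀ k, DiscreteTopology (N k)] [∀ k, Module R (N k)]
  {Rk : ℕ → Type} [∀ k, CommRing (Rk k)] [∀ k, IsLocalRing (Rk k)] [∀ k, TopologicalSpace (Rk k)]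
  [∀ k, DiscreteTopology (Rk k)] [∀ k, Algebra ℤ_[p] (Rk k)] [∀ k, Algebra R (Rk k)]
  [∀ k, Module (Rk k) (N k)] [∀ k, IsScalarTower R (Rk k) (N k)]
  {Nbar : Type} [AddCommGroup Nbar] [TopologicalSpace Nbar] [DiscreteTopology Nbar]
  [∀ k, Module (Rk k) Nbar]
  {Nq : ℕ → Finset (HeightOneSpectrum (𝓞 K)) → Type} [∀ k n, AddCommGroup (Nq k n)]
  [∀ k n, TopologicalSpace (Nq k n)] [∀ k n, DiscreteTopology (Nq k n)]
  [∀ k n, Module (Rk k) (Nq k n)] [∀ k n, Module R (Nq k n)]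
  [∀ k n, IsScalarTower R (Rk k) (Nq k n)]

/-! ## §1 The refined setting -/

/-- The topologies of the level rings `R/π^{i+1}` of the refined setting (discrete; bind with `letI`).
[cite: Howard2004HeegnerKolyvagin, §1.6 (arXiv p. 11, L33–34)] -/
@[reducible] def refineInstTop (S : DVRSetting p K R N Rk Nbar Nq) (i : ℕ) : TopologicalSpace (S.QuotRing (i + 1)) :=
  S.quotRingTopology (i + 1)

/-- Discreteness of `refineInstTop` (bind with `haveI`). [cite: Howard2004HeegnerKolyvagin, §1.6 (arXiv p. 11, L33–34)] -/
theorem refineInst_discrete (S : DVRSetting p K R N Rk Nbar Nq) (i : ℕ) :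
    @DiscreteTopology (S.QuotRing (i + 1)) (S.refineInstTop i) :=
  S.quotRing_discreteTopology (i + 1)

/-- The level rings `R/π^{i+1}` are local (bind with `haveI`). [cite: Howard2004HeegnerKolyvagin, §1.6 (arXiv p. 11, L33–34)] -/
theorem refineInst_isLocalRing (S : DVRSetting p K R N Rk Nbar Nq) (hy : S.SatisfiesH) (i : ℕ) :
    IsLocalRing (S.QuotRing (i + 1)) :=
  S.isLocalRing_quotRing hy (Nat.succ_pos i)

/-- The H.4 datum of the refined level `i`, CHOSEN from R4a's existence theorem
(`exists_dualityDatum_modIdeal` at the host of `i+1`). [cite: Howard2004HeegnerKolyvagin, H.4 with Rem. 1.3.1 (arXiv p. 7 L69–82, L125–127)] -/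
def refineD (S : DVRSetting p K R N Rk Nbar Nq) (hy : S.SatisfiesH) (i : ℕ) :
    letI := S.refineInstTop i
    haveI := S.refineInst_discrete i
    DualityDatum p S.cd (S.refinedRep hy i) (S.QuotRing (i + 1)) :=
  letI := S.refineInstTop i
  haveI := S.refineInst_discrete i
  Classical.choose (S.exists_dualityDatum_modIdeal hy (S.le_e_host hy (i + 1)))

/-- The defining identity of the chosen H.4 datum: `e♯ [s] [t] = toQuotRing (e_host s t)`.
[cite: Howard2004HeegnerKolyvagin, H.4 with Rem. 1.3.1 (arXiv p. 7 L69–82, L125–127)] -/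
theorem refineD_spec (S : DVRSetting p K R N Rk Nbar Nq) (hy : S.SatisfiesH) (i : ℕ)
    (s t : N (S.host hy (i + 1))) :
    letI := S.refineInstTop i
    haveI := S.refineInst_discrete i
    (S.refineD hy i).e (Submodule.Quotient.mk s) (Submodule.Quotient.mk t) =
      S.toQuotRing hy (S.le_e_host hy (i + 1)) ((S.D (S.host hy (i + 1))).e s t) :=
  letI := S.refineInstTop i
  haveI := S.refineInst_discrete i
  Classical.choose_spec (S.exists_dualityDatum_modIdeal hy (S.le_e_host hy (i + 1))) s t

/-- The reductions `R/π^{i+2} ↠ R/π^{i+1}` of the refined setting's level rings.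
[cite: Howard2004HeegnerKolyvagin, §1.6 (arXiv p. 11, L33–34)] -/
abbrev refineRedR (S : DVRSetting p K R N Rk Nbar Nq) (i : ℕ) : S.QuotRing (i + 1 + 1) →+* S.QuotRing (i + 1) :=
  Ideal.Quotient.factor (Ideal.span_singleton_le_span_singleton.mpr (pow_dvd_pow S.π (Nat.le_succ (i + 1))))

/-- **The `π`-adic refinement of a `DVRSetting`**: the setting whose level `i` is `T/π^{i+1}T` (hosted on
`T^{(host (i+1))}`) over `R/π^{i+1}`, with Howard's own exponents `e♯ i = i + 1`; same `π`, conjugation datum,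
embedding, `Σ(F)`, `𝓛` and residual representation; triples/residual data/H.4 data/level data from the bricks
R3a/R2b/R4a/R6a; tame finite–singular slots of the pin family `pins`.
[cite: Howard2004HeegnerKolyvagin, §1.6 with Rem. 1.3.1 (arXiv p. 11 L33–38, p. 7 L125–127)] -/
def refine (S : DVRSetting p K R N Rk Nbar Nq) (hy : S.SatisfiesH)
    (pins : ∀ v : HeightOneSpectrum (𝓞 K), TamePin v) :
    letI : ∀ i, TopologicalSpace (S.QuotRing (i + 1)) := fun i => S.refineInstTop i
    haveI : ∀ i, DiscreteTopology (S.QuotRing (i + 1)) := fun i => S.refineInst_discrete i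
    haveI : ∀ i, IsLocalRing (S.QuotRing (i + 1)) := fun i => S.refineInst_isLocalRing hy i
    letI : ∀ i, Module (S.QuotRing (i + 1)) Nbar := fun i => S.residualModule hy i
    DVRSetting p K R (fun i => S.refinedCarrier hy i) (fun i => S.QuotRing (i + 1)) Nbar
      (fun i n => LevelData.QuotCarrier (S.QuotRing (i + 1)) (S.refinedRep hy i) n) :=
  letI : ∀ i, TopologicalSpace (S.QuotRing (i + 1)) := fun i => S.refineInstTop i
  haveI : ∀ i, DiscreteTopology (S.QuotRing (i + 1)) := fun i => S.refineInst_discrete i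
  haveI : ∀ i, IsLocalRing (S.QuotRing (i + 1)) := fun i => S.refineInst_isLocalRing hy i
  letI : ∀ i, Module (S.QuotRing (i + 1)) Nbar := fun i => S.residualModule hy i
  { π := S.π
    e := fun i => i + 1
    T := S.refinedTower hy
    cd := S.cd
    jbar := S.jbar
    Sigma := S.Sigma
    L := S.L
    t := fun i => S.refinedTriple hy (i + 1)
    ρbar := S.ρbar
    πbar := fun i => S.levelToResidual hy i (S.host hy (i + 1))
    A := fun i => S.residualTauQuot hy i
    D := fun i => S.refineD hy i
    redR := fun i => S.refineRedR i
    LD := fun i => S.refinedLD hy pins i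
    rq := fun i n => S.refinedRq hy i n
    rq_comp := fun _ _ _ => rfl
    rq_equivariant := fun i n g y => S.refinedRq_equivariant hy i n g y
    fsQ := fun i n v => S.refinedFsQ hy pins i n v }

/-! ## §2 The hypotheses H.0–H.5 of the refined setting, clause by clause -/

/-- The reduction of the refined tower on classes: `red♯ [z] = [redLE z]` (hosts `host (i+1) ≤ host (i+2)`).
[cite: Howard2004HeegnerKolyvagin, §1.6 (arXiv p. 11, L33–36)] -/
theorem refinedRed_mk (S : DVRSetting p K R N Rk Nbar Nq) (hy : S.SatisfiesH) (i : ℕ) (z : N (S.host hy (i + 1 + 1))) :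
    S.refinedRed hy i (Submodule.Quotient.mk z) =
      Submodule.Quotient.mk (S.T.redLE (S.host_mono hy (Nat.le_succ (i + 1))) z) := by
  have hz : (Submodule.Quotient.mk z : S.refinedCarrier hy (i + 1)) =
      (S.piRefinementDatum hy).proj (le_refl ((S.piRefinementDatum hy).host (i + 1 + 1))) z := by
    rw [PiRefinementDatum.proj_apply, (S.piRefinementDatum hy).red_refl]
    rfl
  change (S.piRefinementDatum hy).map (i + 1 + 1) (i + 1) _ = _
  rw [hz, (S.piRefinementDatum hy).map_proj (i + 1 + 1) (i + 1) le_rfl (S.host_mono hy (Nat.le_succ (i + 1))),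
    Nat.sub_eq_zero_of_le (Nat.le_succ _), pow_zero, one_smul, PiRefinementDatum.proj_apply]
  rfl

/-- **`ker red♯ = 𝔪^{i+1} · (T/π^{i+2}T)`** (exactness of the refined tower, `ker_red♯`).
[cite: Howard2004HeegnerKolyvagin, §1.6 (arXiv p. 11, L33–36)] -/
theorem ker_refinedRed (S : DVRSetting p K R N Rk Nbar Nq) (hy : S.SatisfiesH) (i : ℕ) :
    LinearMap.ker (S.refinedRed hy i) =
      (IsLocalRing.maximalIdeal R ^ (i + 1)) • (⊤ : Submodule R (S.refinedCarrier hy (i + 1))) := by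
  rw [hy.unif, Ideal.span_singleton_pow]
  apply le_antisymm
  · intro x hx
    rw [LinearMap.mem_ker] at hx
    have h := (S.piRefinementDatum hy).map_eq_zero_iff 1 (i + 1)
    rw [Nat.add_comm 1 (i + 1)] at h
    obtain ⟨z, hz⟩ := (h x).mp hx
    have h1 : (S.piRefinementDatum hy).host 1 ≤ (S.piRefinementDatum hy).host (i + 1 + 1) :=
      (S.piRefinementDatum hy).host_mono (by omega)
    obtain ⟨w, rfl⟩ := (S.piRefinementDatum hy).proj_surjective h1 z
    rw [(S.piRefinementDatum hy).map_proj 1 (i + 1 + 1) h1 le_rfl, Nat.add_sub_cancel] at hz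
    rw [← hz]
    exact Submodule.smul_mem_smul (Ideal.mem_span_singleton_self _) Submodule.mem_top
  · refine Submodule.smul_le.mpr fun r hr x _ => ?_
    obtain ⟨a, rfl⟩ := Ideal.mem_span_singleton'.mp hr
    rw [LinearMap.mem_ker, map_smul, mul_smul]
    exact (congrArg (a • ·) ((S.piRefinementDatum hy).pow_smul_level_eq_zero (i + 1) _)).trans (smul_zero a)

/-- **`πbar_red♯`**: the residual presentations of the refined levels are compatible with the reduction.
[cite: Howard2004HeegnerKolyvagin, H.1 and §1.6 (arXiv p. 7 L59, p. 11 L33–38)] -/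
theorem levelToResidual_refinedRed (S : DVRSetting p K R N Rk Nbar Nq) (hy : S.SatisfiesH) (i : ℕ)
    (y : S.refinedCarrier hy (i + 1)) :
    S.levelToResidual hy i (S.host hy (i + 1)) (S.refinedRed hy i y) =
      S.levelToResidual hy (i + 1) (S.host hy (i + 1 + 1)) y := by
  obtain ⟨z, rfl⟩ := Submodule.mkQ_surjective _ y
  rw [Submodule.mkQ_apply, S.refinedRed_mk hy i z, S.levelToResidual_mk, S.levelToResidual_mk, S.πbar_redLE hy]

/-- **`e_red♯`**: the chosen H.4 data of consecutive refined levels are compatible with the reductions.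
[cite: Howard2004HeegnerKolyvagin, H.4 and §1.6 (arXiv p. 7 L69–82, p. 11 L33–38)] -/
theorem refineRedR_refineD_e (S : DVRSetting p K R N Rk Nbar Nq) (hy : S.SatisfiesH) (i : ℕ)
    (x y : S.refinedCarrier hy (i + 1)) :
    letI : ∀ i, TopologicalSpace (S.QuotRing (i + 1)) := fun i => S.refineInstTop i
    haveI : ∀ i, DiscreteTopology (S.QuotRing (i + 1)) := fun i => S.refineInst_discrete i
    S.refineRedR i ((S.refineD hy (i + 1)).e x y) = (S.refineD hy i).e (S.refinedRed hy i x) (S.refinedRed hy i y) := by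
  letI : ∀ i, TopologicalSpace (S.QuotRing (i + 1)) := fun i => S.refineInstTop i
  haveI : ∀ i, DiscreteTopology (S.QuotRing (i + 1)) := fun i => S.refineInst_discrete i
  obtain ⟨x, rfl⟩ := Submodule.mkQ_surjective _ x
  obtain ⟨y, rfl⟩ := Submodule.mkQ_surjective _ y
  rw [Submodule.mkQ_apply, Submodule.mkQ_apply, S.refinedRed_mk hy i x, S.refinedRed_mk hy i y]
  exact S.e_red_level hy (Nat.le_succ (i + 1)) (S.host_mono hy (Nat.le_succ (i + 1))) (S.le_e_host hy (i + 1))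
    (S.le_e_host hy (i + 1 + 1)) (S.refineD hy i) (S.refineD_spec hy i) (S.refineD hy (i + 1))
    (S.refineD_spec hy (i + 1)) x y

/-- **`h4♯`**: the chosen H.4 datum of the refined level `i` is self-orthogonal for the refined condition
(w8 g10's `isSelfOrthogonal_propagateStructure_modIdeal` over LEAD g12's base change, read on `refinedCond` through
`propagateStructure_levelRep_eq`). [cite: Howard2004HeegnerKolyvagin, H.4 with Rem. 1.3.1 (arXiv p. 7 L69–82, L125–127)] -/
theorem refineD_isSelfOrthogonal (S : DVRSetting p K R N Rk Nbar Nq) (hy : S.SatisfiesH) (i : ℕ) :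
    letI : ∀ i, TopologicalSpace (S.QuotRing (i + 1)) := fun i => S.refineInstTop i
    haveI : ∀ i, DiscreteTopology (S.QuotRing (i + 1)) := fun i => S.refineInst_discrete i
    (S.refineD hy i).IsSelfOrthogonal (S.refinedCond hy (i + 1)) := by
  letI : ∀ i, TopologicalSpace (S.QuotRing (i + 1)) := fun i => S.refineInstTop i
  haveI : ∀ i, DiscreteTopology (S.QuotRing (i + 1)) := fun i => S.refineInst_discrete i
  have h := S.isSelfOrthogonal_propagateStructure_modIdeal hy (S.le_e_host hy (i + 1)) (S.refineD hy i)
    (S.refineD_spec hy i)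
  have e := S.propagateStructure_levelRep_eq hy (i + 1)
  change (S.refineD hy i).IsSelfOrthogonal
    (((S.piRefinementDatum hy).isQuotientBy_levelRep (le_refl ((S.piRefinementDatum hy).host (i + 1)))).propagateStructure
      (S.t ((S.piRefinementDatum hy).host (i + 1))).cond)
  rw [e]
  exact h

/-- **`h5c♯`** (w8 g10's `h5c_level` at the host, for the chosen datum).
[cite: Howard2004HeegnerKolyvagin, H.5(c) with Rem. 1.3.1 (arXiv p. 7 L98 – p. 8 L1, p. 7 L125–127)] -/
theorem refineD_h5c (S : DVRSetting p K R N Rk Nbar Nq) (hy : S.SatisfiesH) (i : ℕ) :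
    letI : ∀ i, TopologicalSpace (S.QuotRing (i + 1)) := fun i => S.refineInstTop i
    haveI : ∀ i, DiscreteTopology (S.QuotRing (i + 1)) := fun i => S.refineInst_discrete i
    haveI : ∀ i, IsLocalRing (S.QuotRing (i + 1)) := fun i => S.refineInst_isLocalRing hy i
    letI : ∀ i, Module (S.QuotRing (i + 1)) Nbar := fun i => S.residualModule hy i
    H5c (S.refineD hy i) (S.levelToResidual hy i (S.host hy (i + 1))) (S.residualTauQuot hy i) :=
  S.h5c_level hy i (S.host hy (i + 1)) (S.le_e_host hy (i + 1)) (S.refineD hy i) (S.refineD_spec hy i)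

/-- **`h5b♯`**: the refined condition propagated to `T̄` is `G_ℚ`-stable (w8 g10's `h5b_level` at the host, read on
`refinedCond` through `propagateStructure_levelRep_eq`). [cite: Howard2004HeegnerKolyvagin, H.5(b) with Rem. 1.3.1 (arXiv p. 7 L96–97, L125–127)] -/
theorem refine_h5b (S : DVRSetting p K R N Rk Nbar Nq) (hy : S.SatisfiesH) (i : ℕ) :
    haveI : ∀ i, IsLocalRing (S.QuotRing (i + 1)) := fun i => S.refineInst_isLocalRing hy i
    letI : ∀ i, Module (S.QuotRing (i + 1)) Nbar := fun i => S.residualModule hy i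
    H5b (R := S.QuotRing (i + 1)) (S.refinedRep hy i) (S.isQuotientBy_levelToResidual hy i (S.host hy (i + 1)))
      (S.residualTauQuot hy i) (S.refinedCond hy (i + 1)) := by
  haveI : ∀ i, IsLocalRing (S.QuotRing (i + 1)) := fun i => S.refineInst_isLocalRing hy i
  letI : ∀ i, Module (S.QuotRing (i + 1)) Nbar := fun i => S.residualModule hy i
  have h := S.h5b_level hy i (S.host hy (i + 1))
  have e := S.propagateStructure_levelRep_eq hy (i + 1)
  change H5b (R := S.QuotRing (i + 1)) (S.refinedRep hy i) (S.isQuotientBy_levelToResidual hy i (S.host hy (i + 1)))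
    (S.residualTauQuot hy i)
    (((S.piRefinementDatum hy).isQuotientBy_levelRep (le_refl ((S.piRefinementDatum hy).host (i + 1)))).propagateStructure
      (S.t ((S.piRefinementDatum hy).host (i + 1))).cond)
  rw [e]
  exact h

/-- **The refined setting satisfies H.0–H.5** (every clause of `SatisfiesH`, levelwise, with the tower
compatibilities and the finite–singular pins) — Howard's Remark 1.3.1 «hypotheses H.0–H.5 are stable under base
change» for the tower `T/π^{i+1}T`, assembled from the bricks R1–R7♯ of the cell.
[cite: Howard2004HeegnerKolyvagin, §1.3 H.0–H.5 with Rem. 1.3.1 and §1.6 (arXiv p. 7 L55 – p. 8 L1, p. 7 L125–127, p. 11 L33–38)] -/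
theorem refine_satisfiesH (S : DVRSetting p K R N Rk Nbar Nq) (hy : S.SatisfiesH)
    (pins : ∀ v : HeightOneSpectrum (𝓞 K), TamePin v) :
    letI : ∀ i, TopologicalSpace (S.QuotRing (i + 1)) := fun i => S.refineInstTop i
    haveI : ∀ i, DiscreteTopology (S.QuotRing (i + 1)) := fun i => S.refineInst_discrete i
    haveI : ∀ i, IsLocalRing (S.QuotRing (i + 1)) := fun i => S.refineInst_isLocalRing hy i
    letI : ∀ i, Module (S.QuotRing (i + 1)) Nbar := fun i => S.residualModule hy i
    (S.refine hy pins).SatisfiesH := by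
  letI : ∀ i, TopologicalSpace (S.QuotRing (i + 1)) := fun i => S.refineInstTop i
  haveI : ∀ i, DiscreteTopology (S.QuotRing (i + 1)) := fun i => S.refineInst_discrete i
  haveI : ∀ i, IsLocalRing (S.QuotRing (i + 1)) := fun i => S.refineInst_isLocalRing hy i
  letI : ∀ i, Module (S.QuotRing (i + 1)) Nbar := fun i => S.residualModule hy i
  haveI : ∀ i n, Finite (LevelData.QuotCarrier (S.QuotRing (i + 1)) (S.refinedRep hy i) n) :=
    fun i n => S.finite_refinedQuotCarrier hy i n
  have hfsQ : ∀ (i : ℕ) (n : Finset (HeightOneSpectrum (𝓞 K))) (v : HeightOneSpectrum (𝓞 K))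
      (x : galoisCohomology (GaloisRep.toLocal v (((S.refine hy pins).LD (i + 1)).ρq n)) 1),
      (S.refine hy pins).fsQ i n v (singularMap _ x) = singularMap _ ((S.refine hy pins).rqLocH1 i n v x) :=
    fun i n v x => S.refinedFsQ_singularMap hy pins i n v x
  exact
    { coeffRing := hy.coeffRing
      p_odd := hy.p_odd
      imagQuad := hy.imagQuad
      unif := hy.unif
      e_strictMono := fun a b hab => Nat.succ_lt_succ hab
      e_zero := Nat.succ_pos 0
      killed := fun i r hr x => S.maximalIdeal_pow_smul_level_eq_zero hy (i + 1) r hr x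
      ker_red := fun i => S.ker_refinedRed hy i
      algebraMap_surjective := fun i => Ideal.Quotient.mk_surjective
      ker_algebraMap := fun i => by
        change RingHom.ker (Ideal.Quotient.mk (Ideal.span {S.π ^ (i + 1)})) = IsLocalRing.maximalIdeal R ^ (i + 1)
        rw [Ideal.mk_ker, hy.unif, Ideal.span_singleton_pow]
      redR_comp := fun i r =>
        Ideal.Quotient.factor_mk (Ideal.span_singleton_le_span_singleton.mpr (pow_dvd_pow S.π (Nat.le_succ (i + 1)))) r
      scalarLinear := fun i => S.isScalarLinear_modIdeal_quotRing (i + 1) (S.host hy (i + 1))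
      h0 := fun i => S.h0_quotLevel hy (Nat.succ_pos i) (S.le_e_host hy (i + 1))
      Sigma_eq := fun _ => rfl
      cond_smul := fun i v r => S.refinedCond_smul hy (i + 1) v r
      cond_red := fun i v => S.refinedCond_map_red hy i v
      L_subset := S.L_subset_degreeTwoPrimes_refinedTower hy
      L_disjoint := hy.L_disjoint
      primes_eq := fun _ => rfl
      h1 := fun i => S.h1_quotLevel hy i (S.host hy (i + 1))
      πbar_red := fun i y => S.levelToResidual_refinedRed hy i y
      h2 := S.h2Tower_refinedTower hy
      h3 := fun i => S.h3_refinedTriple hy (i + 1)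
      h4 := fun i => S.refineD_isSelfOrthogonal hy i
      e_red := fun i x y => S.refineRedR_refineD_e hy i x y
      θ_eq := fun _ _ => rfl
      h5a := fun i => S.h5a_residualTauQuot hy i
      h5b := fun i => S.refine_h5b hy i
      h5c := fun i => S.refineD_h5c hy i
      fsQ_spec := hfsQ
      fs_natural := fun i n v x =>
        DVRSetting.fs_natural_of_fs_eq_tameSlotOn (S.refine hy pins) pins (fun n v => n ∈ levels S.L ∧ v ∈ n)
          (fun i => S.tameHyp_refined hy i) (fun i => rfl) hfsQ i n v x
      fs_admissible := fun i => S.refinedLD_isFsAdmissible hy pins i }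

/-! ## §3 `𝓛_s ⊂ 𝓛` for the refined setting -/

/-- **`LargePrimes` transfers to the refined setting and back** (R7-TOWER♯ `largePrimes_refinedTower_iff`).
[cite: Howard2004HeegnerKolyvagin, §1.6 (arXiv p. 11, L15–16)] -/
theorem refine_largePrimes_iff (S : DVRSetting p K R N Rk Nbar Nq) (hy : S.SatisfiesH)
    (pins : ∀ v : HeightOneSpectrum (𝓞 K), TamePin v) :
    letI : ∀ i, TopologicalSpace (S.QuotRing (i + 1)) := fun i => S.refineInstTop i
    haveI : ∀ i, DiscreteTopology (S.QuotRing (i + 1)) := fun i => S.refineInst_discrete i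
    haveI : ∀ i, IsLocalRing (S.QuotRing (i + 1)) := fun i => S.refineInst_isLocalRing hy i
    letI : ∀ i, Module (S.QuotRing (i + 1)) Nbar := fun i => S.residualModule hy i
    (S.refine hy pins).LargePrimes ↔ S.LargePrimes :=
  S.largePrimes_refinedTower_iff hy

end DVRSetting

end Literature.NumberTheory.GaloisCohomology.Howard2004

end
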